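import Summits.Ventures.PercRepro.RLSTailAssembly
import Summits.Ventures.PercRepro.RLSStarStarArith

/-!
# C-025 at q = 3: the tail lemma FROM THE LINE PROFILE — the capstone of the ≥ 10-point case (night-3 g2)

For a simple plane `G` on `g ≥ 10` points with longest line of `k ≤ g − 2` points and the other lines `ks`, the exact counts of plan §2.6
are `w = 2^g − S(g,5) − Σ_ℓ [(2^{|ℓ|} − S(|ℓ|,5)) + (g − |ℓ|)(2^{|ℓ|} − S(|ℓ|,4))]` winners and `np = Σ_ℓ (g − |ℓ|)(2^{|ℓ|} − S(|ℓ|,3))`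
near-pencil-shaped subsets (`wProfile`, `npProfile` below, summed over ALL lines `k :: ks`), while `n₃, n₄, n₅ ≤ C(g, 3), C(g, 4), C(g, 5)`.
`RLSStarStarArith.profile_le_A` turns the two combinatorial constraints of N3-TAIL-LOSSY.md §6 (ii) into the count
`n₃/3 + 0.27·n₄ + 0.17·n₅ + 0.014·np ≤ w`, and the assembly (`RLSTailAssembly`) turns the count into the per-plane inequality.  The five
theorems `tail_profile_*` below chain the two: their ONLY inputs are the profile constraints, the bounds on `n₃, n₄, n₅` and `p ≥ 8` — every
other step of the tail lemma for planes with `≥ 10` points (generic world at `t = 1, 2, 3`; dependent-witness worlds at `t = 1, 2`) is in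
the kernel.  What remains on paper: that a simple plane's line profile satisfies the two constraints, the exact counts `w`, `np`, and the
loss inventory (§2/§8) behind the `t = 1, 2` dependent-witness rates.  No `decide`.
-/

open PercRepro.NightThree PercRepro.NightThree.CF PercRepro.NightThree.StarStar

namespace PercRepro.NightThree.TailProfile

open Finset

/-- The winners of a plane with line profile `ls` (all lines, as point counts): `2^g − S(g,5) − Σ_ℓ [(2^{|ℓ|} − S(|ℓ|,5)) + (g−|ℓ|)(2^{|ℓ|} − S(|ℓ|,4))]`. -/
def wProfile (g : ℕ) (ls : List ℕ) : ℚ :=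
  2 ^ g - S g 5 - (ls.map (fun k => (2 ^ k - S k 5) + ((g : ℚ) - k) * (2 ^ k - S k 4))).sum

/-- The near-pencil-shaped subsets of a plane with line profile `ls`: `Σ_ℓ (g−|ℓ|)(2^{|ℓ|} − S(|ℓ|,3))`. -/
def npProfile (g : ℕ) (ls : List ℕ) : ℚ := (ls.map (fun k => ((g : ℚ) - k) * (2 ^ k - S k 3))).sum

/-- `Σ_ℓ cost_g(|ℓ|) = (2^g − S(g,5) − w) + 0.014·np`. -/
theorem sum_cost_eq (g : ℕ) (ls : List ℕ) :
    (ls.map (cost g)).sum = (2 ^ g - S g 5 - wProfile g ls) + 14 / 1000 * npProfile g ls := by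
  unfold wProfile npProfile
  induction ls with
  | nil =>
    simp only [List.map_nil, List.sum_nil]
    ring
  | cons a t ih =>
    simp only [List.map_cons, List.sum_cons] at ih ⊢
    rw [ih]
    unfold cost
    ring

/-- `np ≥ 0` when every line has at most `g` points. -/
theorem npProfile_nonneg (g : ℕ) (ls : List ℕ) (h : ∀ k ∈ ls, k ≤ g) : 0 ≤ npProfile g ls := by
  unfold npProfile
  apply List.sum_nonneg
  intro x hx
  rw [List.mem_map] at hx
  obtain ⟨k, hk, rfl⟩ := hx
  have h1 : (k : ℚ) ≤ g := by exact_mod_cast h k hk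
  have h2 := S_le_two_pow k 3
  nlinarith

/-- The count `n₃/3 + 0.27·n₄ + 0.17·n₅ + 0.014·np ≤ w` from the profile constraints (`profile_le_A`) and `n_b ≤ C(g, b)`. -/
theorem count_of_profile (g k : ℕ) (ks : List ℕ) (hg : 10 ≤ g) (hk : k + 2 ≤ g)
    (hle : ∀ k' ∈ ks, k' ≤ min k (g - k + 1))
    (hpairs : (ks.map (fun k' => (k' - 1).choose 2)).sum ≤ (g - k).choose 2)
    (n3 n4 n5 : ℕ) (h3 : n3 ≤ g.choose 3) (h4 : n4 ≤ g.choose 4) (h5 : n5 ≤ g.choose 5) :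
    (n3 : ℚ) / 3 + 27 / 100 * n4 + 17 / 100 * n5 + 14 / 1000 * npProfile g (k :: ks) ≤ wProfile g (k :: ks) := by
  have hA := profile_le_A g k ks hg hk hle hpairs
  have hsum := sum_cost_eq g (k :: ks)
  simp only [List.map_cons, List.sum_cons] at hsum
  have h3' : (n3 : ℚ) ≤ (g.choose 3 : ℚ) := by exact_mod_cast h3
  have h4' : (n4 : ℚ) ≤ (g.choose 4 : ℚ) := by exact_mod_cast h4
  have h5' : (n5 : ℚ) ≤ (g.choose 5 : ℚ) := by exact_mod_cast h5
  unfold A at hA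
  linarith

/-- The ℚ-valued assembly with the near-pencil rate: the linear-arithmetic step with rational (nonnegative) counts. -/
theorem assemble (Φ T0 T1 T2 tie W lossW lossNP d4 d5 : ℚ) (n3 n4 n5 np w : ℚ)
    (hn3 : 0 ≤ n3) (hn4 : 0 ≤ n4) (hn5 : 0 ≤ n5) (hnp : 0 ≤ np)
    (h1 : Φ * 4 ≤ 3 * T0 + W - lossW) (h2 : Φ * 127 ≤ 300 * T1 - 100 * d4 + 27 * (W - lossW))
    (h3 : Φ * 117 ≤ 800 * T2 - 100 * d5 + 17 * (W - lossW)) (h4 : Φ * 507 ≤ 7 * (W - lossW) + 500 * (tie - lossNP))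
    (h0 : T0 ≤ Φ) (hcount : n3 / 3 + 27 / 100 * n4 + 17 / 100 * n5 + 14 / 1000 * np ≤ w) :
    Φ * (n3 + n4 + n5 + np + w) ≤
      n3 * T0 + n4 * (3 * T1 - d4) + n5 * (8 * T2 - d5) + np * (tie - lossNP) + w * (W - lossW) := by
  have hD : 0 ≤ W - lossW - Φ := by linarith
  have hc := mul_le_mul_of_nonneg_right hcount hD
  nlinarith [mul_le_mul_of_nonneg_left h1 hn3, mul_le_mul_of_nonneg_left h2 hn4, mul_le_mul_of_nonneg_left h3 hn5,
    mul_le_mul_of_nonneg_left h4 hnp]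

/-- The profile hypotheses, bundled: `g ≥ 10`, longest line `k ≤ g − 2`, every other line `≤ min(k, g−k+1)` points, disjoint pair sets
off the longest line, and `n_b ≤ C(g, b)`. -/
structure Profile (g k : ℕ) (ks : List ℕ) (n3 n4 n5 : ℕ) : Prop where
  hg : 10 ≤ g
  hk : k + 2 ≤ g
  hle : ∀ k' ∈ ks, k' ≤ min k (g - k + 1)
  hpairs : (ks.map (fun k' => (k' - 1).choose 2)).sum ≤ (g - k).choose 2
  h3 : n3 ≤ g.choose 3
  h4 : n4 ≤ g.choose 4
  h5 : n5 ≤ g.choose 5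

/-- The count of §6 for a `Profile`. -/
theorem Profile.count {g k : ℕ} {ks : List ℕ} {n3 n4 n5 : ℕ} (P : Profile g k ks n3 n4 n5) :
    (n3 : ℚ) / 3 + 27 / 100 * n4 + 17 / 100 * n5 + 14 / 1000 * npProfile g (k :: ks) ≤ wProfile g (k :: ks) :=
  count_of_profile g k ks P.hg P.hk P.hle P.hpairs n3 n4 n5 P.h3 P.h4 P.h5

/-- `npProfile ≥ 0` for a `Profile` (every line has at most `g` points). -/
theorem Profile.np_nonneg {g k : ℕ} {ks : List ℕ} {n3 n4 n5 : ℕ} (P : Profile g k ks n3 n4 n5) :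
    0 ≤ npProfile g (k :: ks) := by
  apply npProfile_nonneg
  intro k' hk'
  rcases List.mem_cons.mp hk' with h | h
  · subst h; have := P.hk; omega
  · have := P.hle k' h; have := P.hk; omega

/-- **Generic world, `t = 3`, from the profile** (every `p = n + 4 ≥ 8`): `Φ·(n₃ + n₄ + n₅ + np + w) ≤ n₃·u0 + 3n₄·u1 + 8n₅·u2 + np·utie + w·w3`
with `w = wProfile`, `np = npProfile`. -/
theorem tail_profile_t3 (n g k : ℕ) (ks : List ℕ) (n3 n4 n5 : ℕ) (P : Profile g k ks n3 n4 n5) (hn : 4 ≤ n) :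
    (∑ i ∈ range n, ((n + 4).choose (i + 1) : ℚ) / ((i + 4).choose 3 : ℚ)) * (n3 + n4 + n5 + npProfile g (k :: ks) + wProfile g (k :: ks)) ≤
      n3 * U3.u0Sum n + n4 * (3 * U3.u1Sum n - 0) + n5 * (8 * U3.u2Sum n - 0) + npProfile g (k :: ks) * (U3.utieSum n - 0) +
        wProfile g (k :: ks) * (U3.w3Sum n - 0) := by
  have h1 : (∑ i ∈ range n, ((n + 4).choose (i + 1) : ℚ) / ((i + 4).choose 3 : ℚ)) * 4 ≤ 3 * U3.u0Sum n + U3.w3Sum n - 0 := by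
    rcases Nat.lt_or_ge n 5 with h | h
    · interval_cases n; have := SmallP.tail_triple_t3_n4; linarith
    · have := U3.Tail.tail_triple_t3 n h; linarith
  have h2 : (∑ i ∈ range n, ((n + 4).choose (i + 1) : ℚ) / ((i + 4).choose 3 : ℚ)) * 127 ≤ 300 * U3.u1Sum n - 100 * 0 + 27 * (U3.w3Sum n - 0) := by
    rcases Nat.lt_or_ge n 5 with h | h
    · interval_cases n; have := SmallP.tail_four_t3_n4; linarith
    · have := U3.Tail.tail_four_t3 n h; linarith
  have h3 : (∑ i ∈ range n, ((n + 4).choose (i + 1) : ℚ) / ((i + 4).choose 3 : ℚ)) * 117 ≤ 800 * U3.u2Sum n - 100 * 0 + 17 * (U3.w3Sum n - 0) := by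
    rcases Nat.lt_or_ge n 5 with h | h
    · interval_cases n; have := SmallP.tail_five_t3_n4; linarith
    · have := U3.Tail.tail_five_t3 n h; linarith
  have h4 : (∑ i ∈ range n, ((n + 4).choose (i + 1) : ℚ) / ((i + 4).choose 3 : ℚ)) * 507 ≤ 7 * (U3.w3Sum n - 0) + 500 * (U3.utieSum n - 0) := by
    rcases Nat.lt_or_ge n 5 with h | h
    · interval_cases n; have := SmallP.tail_np_t3_n4; linarith
    · have := U3.Tail.tail_np_t3 n h; linarith
  have h0 : U3.u0Sum n ≤ ∑ i ∈ range n, ((n + 4).choose (i + 1) : ℚ) / ((i + 4).choose 3 : ℚ) := TailAssembly.t0_le_phi n 1 (by norm_num)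
  exact assemble _ _ _ _ _ _ _ _ _ _ _ _ _ _ _ (by positivity) (by positivity) (by positivity) P.np_nonneg h1 h2 h3 h4 h0 P.count

/-- **Generic world, `t = 2`, from the profile** (every `p = n + 4 ≥ 8`). -/
theorem tail_profile_t2 (n g k : ℕ) (ks : List ℕ) (n3 n4 n5 : ℕ) (P : Profile g k ks n3 n4 n5) (hn : 4 ≤ n) :
    (∑ i ∈ range n, ((n + 4).choose (i + 1) : ℚ) / ((i + 4).choose 3 : ℚ)) * (n3 + n4 + n5 + npProfile g (k :: ks) + wProfile g (k :: ks)) ≤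
      n3 * U2.r0Sum n + n4 * (3 * U2.r1Sum n - 0) + n5 * (8 * U2.r2Sum n - 0) + npProfile g (k :: ks) * (U2.rtieSum n - 0) +
        wProfile g (k :: ks) * (U2.w2Sum n - 0) := by
  have h1 := U2.Tail.tail_triple_t2 n hn
  have h2 := U2.Tail.tail_four_t2 n hn
  have h3 := U2.Tail.tail_five_t2 n hn
  have h4 := U2.Tail.tail_np_t2 n hn
  have h0 : U2.r0Sum n ≤ ∑ i ∈ range n, ((n + 4).choose (i + 1) : ℚ) / ((i + 4).choose 3 : ℚ) := TailAssembly.t0_le_phi n 2 (by norm_num)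
  exact assemble _ _ _ _ _ _ _ _ _ _ _ _ _ _ _ (by positivity) (by positivity) (by positivity) P.np_nonneg (by linarith) (by linarith)
    (by linarith) (by linarith) h0 P.count

/-- **Generic world, `t = 1`, from the profile** (every `p = n + 4 ≥ 8`). -/
theorem tail_profile_t1 (n g k : ℕ) (ks : List ℕ) (n3 n4 n5 : ℕ) (P : Profile g k ks n3 n4 n5) (hn : 4 ≤ n) :
    (∑ i ∈ range n, ((n + 4).choose (i + 1) : ℚ) / ((i + 4).choose 3 : ℚ)) * (n3 + n4 + n5 + npProfile g (k :: ks) + wProfile g (k :: ks)) ≤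
      n3 * U1.q0Sum n + n4 * (3 * U1.q1Sum n - 0) + n5 * (8 * U1.q2Sum n - 0) + npProfile g (k :: ks) * (U1.qtieSum n - 0) +
        wProfile g (k :: ks) * (U1.w1Sum n - 0) := by
  have h1 := U1.Tail.tail_triple_t1 n hn
  have h2 := U1.Tail.tail_four_t1 n hn
  have h3 := U1.Tail.tail_five_t1 n hn
  have h4 := U1.Tail.tail_np_t1 n hn
  have h0 : U1.q0Sum n ≤ ∑ i ∈ range n, ((n + 4).choose (i + 1) : ℚ) / ((i + 4).choose 3 : ℚ) := TailAssembly.t0_le_phi n 3 (by norm_num)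
  exact assemble _ _ _ _ _ _ _ _ _ _ _ _ _ _ _ (by positivity) (by positivity) (by positivity) P.np_nonneg (by linarith) (by linarith)
    (by linarith) (by linarith) h0 P.count

/-- **Dependent-witness world, `t = 2` (one pair), from the profile** (every `p = n + 4 ≥ 8`): the losses `pt` per near-pencil-shaped
subset and `pw` per winner (N3-TAIL-LOSSY.md §2). -/
theorem tail_profile_lossy_t2 (n g k : ℕ) (ks : List ℕ) (n3 n4 n5 : ℕ) (P : Profile g k ks n3 n4 n5) (hn : 4 ≤ n) :
    (∑ i ∈ range n, ((n + 4).choose (i + 1) : ℚ) / ((i + 4).choose 3 : ℚ)) * (n3 + n4 + n5 + npProfile g (k :: ks) + wProfile g (k :: ks)) ≤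
      n3 * U2.r0Sum n + n4 * (3 * U2.r1Sum n - 0) + n5 * (8 * U2.r2Sum n - 0) + npProfile g (k :: ks) * (U2.rtieSum n - U2.ptSum n) +
        wProfile g (k :: ks) * (U2.w2Sum n - U2.pwSum n) := by
  have h1 := U2.LossyTail.ltail_triple_t2 n hn
  have h2 := U2.LossyTail.ltail_four_t2 n hn
  have h3 := U2.LossyTail.ltail_five_t2 n hn
  have h4 := U2.LossyTail.ltail_np_t2 n hn
  have h0 : U2.r0Sum n ≤ ∑ i ∈ range n, ((n + 4).choose (i + 1) : ℚ) / ((i + 4).choose 3 : ℚ) := TailAssembly.t0_le_phi n 2 (by norm_num)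
  exact assemble _ _ _ _ _ _ _ _ _ _ _ _ _ _ _ (by positivity) (by positivity) (by positivity) P.np_nonneg (by linarith) (by linarith)
    (by linarith) (by linarith) h0 P.count

/-- **Dependent-witness world, `t = 1` (nullity 2), from the profile** (every `p = n + 4 ≥ 8`): the losses `3·pt` per near-pencil-shaped
subset, `3·pw + cw` per winner, `3·ct4` / `9·ct5` per 4- / 5-subset (N3-TAIL-LOSSY.md §2, §8). -/
theorem tail_profile_lossy_t1 (n g k : ℕ) (ks : List ℕ) (n3 n4 n5 : ℕ) (P : Profile g k ks n3 n4 n5) (hn : 4 ≤ n) :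
    (∑ i ∈ range n, ((n + 4).choose (i + 1) : ℚ) / ((i + 4).choose 3 : ℚ)) * (n3 + n4 + n5 + npProfile g (k :: ks) + wProfile g (k :: ks)) ≤
      n3 * U1.q0Sum n + n4 * (3 * U1.q1Sum n - 3 * U1.ct4Sum n) + n5 * (8 * U1.q2Sum n - 9 * U1.ct5Sum n) +
        npProfile g (k :: ks) * (U1.qtieSum n - 3 * U1.ptSum n) + wProfile g (k :: ks) * (U1.w1Sum n - (U1.cwSum n + 3 * U1.pwSum n)) := by
  have h1 := U1.LossyTail.ltail_triple_t1 n hn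
  have h2 := U1.LossyTail.ltail_four_t1 n hn
  have h3 := U1.LossyTail.ltail_five_t1 n hn
  have h4 := U1.LossyTail.ltail_np_t1 n hn
  have h0 : U1.q0Sum n ≤ ∑ i ∈ range n, ((n + 4).choose (i + 1) : ℚ) / ((i + 4).choose 3 : ℚ) := TailAssembly.t0_le_phi n 3 (by norm_num)
  exact assemble _ _ _ _ _ _ _ _ _ _ _ _ _ _ _ (by positivity) (by positivity) (by positivity) P.np_nonneg (by linarith) (by linarith)
    (by linarith) (by linarith) h0 P.count

end PercRepro.NightThree.TailProfile
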